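import Mathlib
import HarnessLib
import Summits.HubbardSuperconductivity.HubbardSuperconductivity.Theorems.KLProgrammeKLRegimeTwoVolumeGridPeriodisationLegs
import Summits.HubbardSuperconductivity.HubbardSuperconductivity.Theorems.KLProgrammeKLRegimeVolumeLimitGridCovariancePeriodisation
import Literature.MathematicalPhysics.QuantumLattice.HubbardSectorGridOverlapReindex

/-!
# Route `KLProgramme` — crux K3, VL child (stmt-HubbardSuperconductivity-20440), (vi) blueprint v4 M3-grid: the CROSS-GRID OVERLAP KERNEL `E_V(F) · S_V^{grid}`
# (sector analysis of the scale-`0` grid action) PERIODISES in the column fibre (cell gate-hubbard-kl, seat hubbard-kl-k3c4-p1 g11; `--supports` stmt-…-20440)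

The transition `0 → 1` of the two-volume induction re-sectorises the GRID effective action of scale `0` (legs `GridLeg (GridPoint V (2(2M)))`, the object of
`hubbardGrid_sum_norm_kernel_twoVolume_stepZero_le`) into the sector-field legs of the first sectorised family: the substitution is
`T_V = ε • E_V(F₁) · S_V^{grid}` (`klEffectiveAction_zero_eq_effAction_map`, `sectorPreimage_eq_map_smul_sectorAnalysis`).  The abstract scale successor needs its
periodisation `(P_T)`: the fine overlap kernel summed over the fibre of a coarse GRID column equals the coarse overlap kernel at the projected sector row.  With the
character form of the cross-grid kernel (`Literature.…HubbardSectorGridOverlapReindex.sectorAnalysis_mul_hubbardGridSub_apply_eq_char`: `(E_F S)((y,ℓ),((q,σ),c)) =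
(βV²)⁻¹·u_c(q₀,y₀)·Σ_k F_ω(k)·Χ_c(k; q₀−2y₀, q⃗−y⃗)`) and a SAMPLED family `F_V ω (i,q) = 𝔣 ω i (p_q)`, the spatial factor is the one-frequency propagator of
`…GridPeriodisationLegs.periodise_spatialPropagator_left` / `…GridCovariancePeriodisation.periodise_spatialPropagator`, and the temporal factor is volume-free:

* `gridOverlap_zero_periodise`, `gridOverlap_one_periodise` (per charge), **`gridOverlap_periodise_leg`** (every pair of legs; the `hPT` hypothesis of
  `twoVolume_scale_succ_le` at the transition `0 → 1`).

Everything proved; no definition.  References: BGM 2006 §2.1 (2.5), §2.7 (2.70)–(2.71a); Salmhofer 1999 §4.2.4.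
-/

noncomputable section

namespace Summit.HubbardSuperconductivity.HubbardSuperconductivity.Theorems.TwoPointAssembly

set_option linter.dupNamespace false -- summit = problem name (single-conjunct summit), D-0017

open Finset Complex Literature.MathematicalPhysics.QuantumLattice Literature.Probability.LatticeModels
open scoped ComplexConjugate

section Periodise

variable {b L Lf M N : ℕ} [NeZero Lf] [NeZero L] [NeZero M]

/-- The cross-grid overlap entry at charge `0` for a SAMPLED family, as a one-frequency sum:
`(E_V S_V)((y₀,y⃗),((ω,σ),0)),(((t,q⃗),σ),0)) = Σ_i (u·χ_i(t−2y₀)/β) · (V⁻² Σ_{q} 𝔣 ω i (p_q) χ_q(q⃗ − y⃗))`. [folklore] -/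
theorem gridOverlap_zero_apply_eq_sum {V : ℕ} [NeZero V] {β : ℝ} (hβ : β ≠ 0) (𝔣 : Fin N → MatsubaraIdx M → (Fin 2 → ℝ) → ℂ)
    (F : Fin N → FreqMomentum V M → ℂ) (hF : ∀ ω i q, F ω (i, q) = 𝔣 ω i (latticeMomentum V q))
    (y₀ : ImagTimeIdx M) (y : TorusSite 2 V) (ω : Fin N) (σ : Fin 2) (t : Fin (2 * (2 * M))) (q : TorusSite 2 V) :
    (sectorAnalysisMatrix V M β F * hubbardGridSub V M β (2 * (2 * M))) ((y₀, y), ((ω, σ), 0)) (((t, q), σ), 0) =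
      ∑ i : MatsubaraIdx M,
        (Complex.exp (((Real.pi * (1 - 2 * M) * (((t : ℕ) : ℝ) - 2 * ((y₀ : ℕ) : ℝ)) / (2 * (2 * M)) : ℝ) : ℂ) * I) *
            torusChar (fun _ : Fin 1 => ((i : ℕ) : ZMod (2 * (2 * M))))
              (fun _ : Fin 1 => ((t : ℕ) : ZMod (2 * (2 * M))) - 2 * ((y₀ : ℕ) : ZMod (2 * (2 * M)))) / (β : ℂ)) *
          (((V : ℂ) ^ 2)⁻¹ * ∑ q' : TorusSite 2 V, 𝔣 ω i (latticeMomentum V q') * torusChar q' (q - y)) := by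
  rw [sectorAnalysis_mul_hubbardGridSub_apply_eq_char hβ F (y₀, y) ω σ 0 (t, q)]
  simp only [if_true, Fintype.sum_prod_type, hF]
  have hV : (V : ℂ) ≠ 0 := by exact_mod_cast NeZero.ne V
  have hβ' : (β : ℂ) ≠ 0 := by exact_mod_cast hβ
  rw [Finset.mul_sum, Finset.mul_sum]
  refine Finset.sum_congr rfl fun i _ => ?_
  rw [Finset.mul_sum, Finset.mul_sum, Finset.mul_sum, Finset.mul_sum]
  refine Finset.sum_congr rfl fun q' _ => ?_
  push_cast
  field_simp

/-- The cross-grid overlap entry at charge `1` for a SAMPLED family (conjugate temporal factor, spatial character `χ_q(y⃗ − q⃗)`). [folklore] -/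
theorem gridOverlap_one_apply_eq_sum {V : ℕ} [NeZero V] {β : ℝ} (hβ : β ≠ 0) (𝔣 : Fin N → MatsubaraIdx M → (Fin 2 → ℝ) → ℂ)
    (F : Fin N → FreqMomentum V M → ℂ) (hF : ∀ ω i q, F ω (i, q) = 𝔣 ω i (latticeMomentum V q))
    (y₀ : ImagTimeIdx M) (y : TorusSite 2 V) (ω : Fin N) (σ : Fin 2) (t : Fin (2 * (2 * M))) (q : TorusSite 2 V) :
    (sectorAnalysisMatrix V M β F * hubbardGridSub V M β (2 * (2 * M))) ((y₀, y), ((ω, σ), 1)) (((t, q), σ), 1) =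
      ∑ i : MatsubaraIdx M,
        (conj (Complex.exp (((Real.pi * (1 - 2 * M) * (((t : ℕ) : ℝ) - 2 * ((y₀ : ℕ) : ℝ)) / (2 * (2 * M)) : ℝ) : ℂ) * I)) *
            conj (torusChar (fun _ : Fin 1 => ((i : ℕ) : ZMod (2 * (2 * M))))
              (fun _ : Fin 1 => ((t : ℕ) : ZMod (2 * (2 * M))) - 2 * ((y₀ : ℕ) : ZMod (2 * (2 * M))))) / (β : ℂ)) *
          (((V : ℂ) ^ 2)⁻¹ * ∑ q' : TorusSite 2 V, 𝔣 ω i (latticeMomentum V q') * torusChar q' (y - q)) := by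
  rw [sectorAnalysis_mul_hubbardGridSub_apply_eq_char hβ F (y₀, y) ω σ 1 (t, q)]
  simp only [Fin.one_eq_zero_iff, OfNat.ofNat_ne_one, if_false, Fintype.sum_prod_type, hF, map_mul]
  have hV : (V : ℂ) ≠ 0 := by exact_mod_cast NeZero.ne V
  have hβ' : (β : ℂ) ≠ 0 := by exact_mod_cast hβ
  rw [Finset.mul_sum, Finset.mul_sum]
  refine Finset.sum_congr rfl fun i _ => ?_
  rw [Finset.mul_sum, Finset.mul_sum, Finset.mul_sum, Finset.mul_sum]
  refine Finset.sum_congr rfl fun q' _ => ?_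
  rw [show (starRingEnd ℂ) (torusChar q' (q - y)) = torusChar q' (y - q) by rw [← torusChar_neg_right, neg_sub]]
  push_cast
  field_simp

/-- **Charge `0`: the fine cross-grid overlap kernel summed over the site fibre of the grid column is the coarse one at the projected row.** [folklore] -/
theorem gridOverlap_zero_periodise (hLf : Lf = b * L) {β : ℝ} (hβ : β ≠ 0)
    (𝔣 : Fin N → MatsubaraIdx M → (Fin 2 → ℝ) → ℂ)
    (FL : Fin N → FreqMomentum L M → ℂ) (FLf : Fin N → FreqMomentum Lf M → ℂ)
    (hFL : ∀ ω i q, FL ω (i, q) = 𝔣 ω i (latticeMomentum L q)) (hFLf : ∀ ω i q, FLf ω (i, q) = 𝔣 ω i (latticeMomentum Lf q))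
    (y₀ : ImagTimeIdx M) (y : TorusSite 2 Lf) (ω : Fin N) (σ : Fin 2) (t : Fin (2 * (2 * M))) (qbar : TorusSite 2 L) :
    ∑ q' ∈ univ.filter (fun q' : TorusSite 2 Lf => (fun i => (((q' i).val : ℕ) : ZMod L)) = qbar),
        (sectorAnalysisMatrix Lf M β FLf * hubbardGridSub Lf M β (2 * (2 * M))) ((y₀, y), ((ω, σ), 0)) (((t, q'), σ), 0) =
      (sectorAnalysisMatrix L M β FL * hubbardGridSub L M β (2 * (2 * M)))
        ((y₀, fun i => (((y i).val : ℕ) : ZMod L)), ((ω, σ), 0)) (((t, qbar), σ), 0) := by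
  simp_rw [gridOverlap_zero_apply_eq_sum hβ 𝔣 FLf hFLf]
  rw [gridOverlap_zero_apply_eq_sum hβ 𝔣 FL hFL, Finset.sum_comm]
  refine Finset.sum_congr rfl fun i _ => ?_
  rw [← Finset.mul_sum, periodise_spatialPropagator_left hLf (𝔣 ω i) y qbar]

/-- **Charge `1`: the same** (`periodise_spatialPropagator`). [folklore] -/
theorem gridOverlap_one_periodise (hLf : Lf = b * L) {β : ℝ} (hβ : β ≠ 0)
    (𝔣 : Fin N → MatsubaraIdx M → (Fin 2 → ℝ) → ℂ)
    (FL : Fin N → FreqMomentum L M → ℂ) (FLf : Fin N → FreqMomentum Lf M → ℂ)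
    (hFL : ∀ ω i q, FL ω (i, q) = 𝔣 ω i (latticeMomentum L q)) (hFLf : ∀ ω i q, FLf ω (i, q) = 𝔣 ω i (latticeMomentum Lf q))
    (y₀ : ImagTimeIdx M) (y : TorusSite 2 Lf) (ω : Fin N) (σ : Fin 2) (t : Fin (2 * (2 * M))) (qbar : TorusSite 2 L) :
    ∑ q' ∈ univ.filter (fun q' : TorusSite 2 Lf => (fun i => (((q' i).val : ℕ) : ZMod L)) = qbar),
        (sectorAnalysisMatrix Lf M β FLf * hubbardGridSub Lf M β (2 * (2 * M))) ((y₀, y), ((ω, σ), 1)) (((t, q'), σ), 1) =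
      (sectorAnalysisMatrix L M β FL * hubbardGridSub L M β (2 * (2 * M)))
        ((y₀, fun i => (((y i).val : ℕ) : ZMod L)), ((ω, σ), 1)) (((t, qbar), σ), 1) := by
  simp_rw [gridOverlap_one_apply_eq_sum hβ 𝔣 FLf hFLf]
  rw [gridOverlap_one_apply_eq_sum hβ 𝔣 FL hFL, Finset.sum_comm]
  refine Finset.sum_congr rfl fun i _ => ?_
  rw [← Finset.mul_sum, periodise_spatialPropagator hLf (𝔣 ω i) y qbar]

/-- **`(P_T)` AT EVERY PAIR OF LEGS for the cross-grid overlap kernel.**  For `Lf = b·L`, `β ≠ 0`, the SAME sampled family at both volumes and a block structure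
`e₁` of the fine GRID legs whose projection reduces the site: `Σ_{π Y″ = Y} (E_{Lf} S_{Lf}) X′ Y″ = (E_L S_L) (π X′) Y`, `π X′ = ((y₀, red y⃗), ℓ)`. [folklore] -/
theorem gridOverlap_periodise_leg (hLf : Lf = b * L) {β : ℝ} (hβ : β ≠ 0)
    (𝔣 : Fin N → MatsubaraIdx M → (Fin 2 → ℝ) → ℂ)
    (FL : Fin N → FreqMomentum L M → ℂ) (FLf : Fin N → FreqMomentum Lf M → ℂ)
    (hFL : ∀ ω i q, FL ω (i, q) = 𝔣 ω i (latticeMomentum L q)) (hFLf : ∀ ω i q, FLf ω (i, q) = 𝔣 ω i (latticeMomentum Lf q))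
    {ι : Type*} (e₁ : GridLeg (GridPoint Lf (2 * (2 * M))) ≃ ι × GridLeg (GridPoint L (2 * (2 * M))))
    (he₁2 : ∀ X', (e₁ X').2 = (((X'.1.1.1, fun i => (((X'.1.1.2 i).val : ℕ) : ZMod L)), X'.1.2), X'.2))
    (X' : SpaceTimeIdx Lf M × SectorLeg N) (Y : GridLeg (GridPoint L (2 * (2 * M)))) :
    ∑ Y'' ∈ univ.filter (fun Y'' : GridLeg (GridPoint Lf (2 * (2 * M))) => (e₁ Y'').2 = Y),
        (sectorAnalysisMatrix Lf M β FLf * hubbardGridSub Lf M β (2 * (2 * M))) X' Y'' =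
      (sectorAnalysisMatrix L M β FL * hubbardGridSub L M β (2 * (2 * M))) ((X'.1.1, fun i => (((X'.1.2 i).val : ℕ) : ZMod L)), X'.2) Y := by
  classical
  -- the fibre of the grid leg `Y` is the site fibre of its site, at the time/spin/charge of `Y`
  have hfib : ∑ Y'' ∈ univ.filter (fun Y'' : GridLeg (GridPoint Lf (2 * (2 * M))) => (e₁ Y'').2 = Y),
        (sectorAnalysisMatrix Lf M β FLf * hubbardGridSub Lf M β (2 * (2 * M))) X' Y'' =
      ∑ q' ∈ univ.filter (fun q' : TorusSite 2 Lf => (fun i => (((q' i).val : ℕ) : ZMod L)) = Y.1.1.2),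
        (sectorAnalysisMatrix Lf M β FLf * hubbardGridSub Lf M β (2 * (2 * M))) X' (((Y.1.1.1, q'), Y.1.2), Y.2) := by
    refine Finset.sum_bij' (fun Y'' _ => Y''.1.1.2) (fun q' _ => (((Y.1.1.1, q'), Y.1.2), Y.2)) ?_ ?_ ?_ ?_ ?_
    · intro Y'' hY''
      simp only [mem_filter, mem_univ, true_and] at hY'' ⊢
      rw [he₁2] at hY''
      rw [← hY'']
    · intro q' hq'
      simp only [mem_filter, mem_univ, true_and] at hq' ⊢
      rw [he₁2, hq']
    · intro Y'' hY''
      simp only [mem_filter, mem_univ, true_and] at hY''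
      rw [he₁2] at hY''
      rw [← hY'']
    · intro q' hq'
      rfl
    · intro Y'' hY''
      simp only [mem_filter, mem_univ, true_and] at hY''
      rw [he₁2] at hY''
      rw [← hY'']
  rw [hfib]
  obtain ⟨⟨y₀, y⟩, ⟨⟨ω, σ'⟩, c'⟩⟩ := X'
  obtain ⟨⟨⟨t, qbar⟩, σ⟩, c⟩ := Y
  dsimp only
  by_cases h : σ = σ' ∧ c = c'
  · obtain ⟨hσ, hc⟩ := h
    subst hσ; subst hc
    fin_cases c
    · exact gridOverlap_zero_periodise hLf hβ 𝔣 FL FLf hFL hFLf y₀ y ω σ t qbar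
    · exact gridOverlap_one_periodise hLf hβ 𝔣 FL FLf hFL hFLf y₀ y ω σ t qbar
  · -- different spins or charges: both sides vanish
    rw [sectorAnalysis_mul_hubbardGridSub_apply, if_neg h]
    exact sum_eq_zero fun q' _ => by rw [sectorAnalysis_mul_hubbardGridSub_apply, if_neg h]

end Periodise

end Summit.HubbardSuperconductivity.HubbardSuperconductivity.Theorems.TwoPointAssembly

end
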